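import Summits.QuantumFields.YangMills.Theorems.IR.Negative.OuterCertFalseOfWire
import Summits.QuantumFields.YangMills.Cruxes.IR.Lines.birth
import Literature.MathematicalPhysics.QuantumLattice.WilsonBlockHeatBath

/-!
# Crux `IR` (stmt-QuantumFields-19354) — ideation seat `ym-cruxidea-19354-3` — Sketch v3.3 (g4 v3–v3.2; g5 §G, 2026-08-27)

Desk file of the R134 (d) ideation seat (NOT a Theorems / Cruxes file; nothing here is registered; v3 is SORRY-FREE:
every `theorem` is a real proof, the research content sits in `def … : Prop` statements).  v3 = v2 (`Sketch-g3v2.lean`,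
sha16 746211078fc855a7) with ONE located repair, answering crux-triage seat 1 rev 6 ITEM 32 («the light-flux witness
bites every TORUS-GLOBAL L² format at `π₁(G) ≠ 1` modulo `H_AI`») and owner R45 (2) («the π₁ ∕ sector handling typed
FIRST, in the STUB TEXT»): the format `TensorizesAt` is re-typed over the TREE's block heat-bath vocabulary
(`Literature/MathematicalPhysics/QuantumLattice/WilsonBlockHeatBath.lean`: `cellOf`, `InBlock`, `extSigma`,
`GlobalPoincare`) as the **light-cone (support-capped) Poincaré inequality** `LightConePoincare` — the tree's
`GlobalPoincare` restricted to gauge-invariant observables depending on the links of a CAPPED BOX of side `3N/4`.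

Why the class moved twice.  v1 (all of `L²`): bitten by the disc-repaired light-flux sign `η̃` (`Var η̃ ≈ 1`,
`Σ_z ‖Q_z η̃‖² ≤ e^{−ε′S}`; tree `Theorems/GapAtCorrelationLength/Negative/GapAtCorrelationLengthFalseOfLightFluxGroup`).
v2 (box of side `N − 1`, margin one lattice unit): bitten by the box FORECAST `F := μ[η̃ | box links]` — box-measurable,
gauge invariant, bounded, and at weak coupling `‖F − η̃‖₂² ≲ e^{−cβN}` because a compensating (sector-flipping) sheet
squeezed into a slab of lattice thickness `1` (free to spread along it) costs action `≍ βN` per torus, so on a large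
torus the box data read the sector and `F` inherits the rigidity of `η̃` (`Σ_z ‖Q_z F‖² ≲ (N/b)⁴ e^{−cβN} + e^{−ε′S}`).
v3 (box of side `≤ 3N/4`): the complement contains, in every axis, a slab `T³ × [0, N/4)` of physical thickness
`≍ S·a/2`, room for a sector-flipping sheet at its NATURAL thickness (relative weight `→ 1` on tori `≫ ξ`: magnetic
flux is light in the confining phase = flux sectors are locally indistinguishable from contractible regions; bounded
below uniformly in `a` on tori of a few `ℓ`: twist-eating moduli live in the wrapping complement), so the sector
posterior given capped-box data is never sharp, `Var μ[η̃ | capped box]` stays comparable to its block-conditional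
variances, and the witness class of item 32 has no address; the photon row stays FALSE (`γ ≲ (b/N)²`) as it must; the class is exactly
what the landed engine shape consumes (knabe S4 applies the gap only to `P^{Λ}_t f̃ ∈ M(Λ)`, `Λ` a non-wrapping light
cone of depth `D ≍ n/(8b)`).  The residual claim (K6′: slab-lightness of magnetic flux given capped-box data) is
RECORDED in the cards, not smuggled: it is part of what stub I_{L²} asserts at `π₁(G) ≠ 1`, and it is a property the
weak-coupling phase is expected to have (unlike v1/v2's classes, for which the tree holds a refuting witness).

* §A FORMAT L² (v3) — `capBox`, `LightConePoincare`, `lightConePoincare_of_globalPoincare` (PROVED: the tree's global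
  inequality implies ours — our format is WEAKER than the bitten waypoint of `Theses/LangevinControlUV.lean`),
  `TensorizesAt` (mesh `b`, constant `C`, every odd torus of side `≥ 4b`), `BlockTensorizationCertificate` (card A).
* `BlockEngineFmt` ∕ `BlockEngine` ∕ `blockEngine_of_fmt` (PROVED) ∕ `ir_of_blockTensorization(′)` (PROVED) — text
  unchanged from v2; meaning updated through `TensorizesAt`.
* §B `tv-wall-split` — unchanged (PROVED seams; w4 calibration row of record, owner R16).
* §D `l2-onset-pincer` — unchanged text: `OnsetTensorization` (I_{L²}), `BlockEngineFmt` (E_{L²}), `AFToOnsetL2`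
  (X_{L²}) and the sorry-free composition `irCal_of_pincerL2` ∕ `ir_of_pincerL2 : … → BalabanLadder.IR`.
* §F NEW — `AFToOnsetAtRep`∕`AFToOnsetAt (fmt : Format)`: the UV stub with the onset functional as a PARAMETER
  (ctriage-1 rev 7 sharpen (iii)); `AFToOnsetL2 := ∀ G r, ∃ C₀ > 0, ∀ C ≥ C₀, AFToOnsetAtRep (tensFmt C) G r`
  (ctriage-2 rev 8 O-L2-2: threshold instead of `∀ C > 0`; composition at `max C C₀` via PROVED `tensorizesAt_mono`).
* §E NEW — the engine delta over the landed toolkit, typed: `DefectContraction` (the replacement of knabe S4's abstract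
  `hSC` when the Poincaré inequality holds only on the light-cone class: Gronwall with a rim defect) and
  `tensorizesAt_of_globalPoincare` (PROVED).
* §G NEW (v3.3, g5 — crux-triage seat 1 rev 8 items 47–49, sharpen (iv)) — the CONSUMED PINNING `X′_{L²}`:
  `OnsetInUnitsAtRep (fmt : Format)` ∕ `OnsetInUnitsAt` (guarded onset-in-units, generic in the format),
  `OnsetInUnitsL2` (threshold form, guard `(tensSet …).Nonempty →` explicit), PROVED `tensSet_mono`, `tensOnset_anti`
  (antitone in `C` only under the guard), `onsetInUnitsL2_of_afToOnsetL2` (X ⇒ X′), `PincerL2Single` +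
  `pincerL2Single_of` (the collapse of `∀ C ≥ C₀` to the single constant `max C_I C₀`), `irCal_of_pincerL2'` ∕
  `ir_of_pincerL2' : BlockEngineFmt → OnsetTensorization → OnsetInUnitsL2 → BalabanLadder.IR` (⊢ `IR` by name) and
  `irCal_of_pincerL2_via_pinning` (the v3.2 composition factors through X′).  Statements of §A–§F UNCHANGED.
-/

set_option autoImplicit false

noncomputable section

open Filter Topology MeasureTheory
open scoped SchwartzMap
open Literature.MathematicalPhysics.QuantumFieldTheory Literature.MathematicalPhysics.QuantumLattice
open Literature.MathematicalPhysics.QuantumLattice.WilsonBlockHeatBath (extSigma)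
open Summit.QuantumFields.YangMills.Cruxes.OSLegsFromFemtoAndGap.DlrCollarTransfer (GapInUnits LowerBounds Q2)
open Summit.QuantumFields.YangMills.Cruxes.IR.Tempered (cellEdges windowCells regionEdges)
open Summit.QuantumFields.YangMills.Cruxes.IR.ShellTempered (windowCellsPlus)
open Summit.QuantumFields.YangMills.Cruxes.IR.OuterCertWire (OuterTemperedCond OuterCertificate IROuterCertificate)
open Summit.QuantumFields.YangMills.Cruxes.IR.CellTempered (IRCal)

namespace Summit.QuantumFields.YangMills.Cruxes.IR.CruxIdea3

/-! ## §A  FORMAT L² (v3): the light-cone (support-capped) block-sampler Poincaré inequality -/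

section LightConeFormat

variable {G : Type} [Group G] [TopologicalSpace G] [IsTopologicalGroup G] [CompactSpace G]
  [MeasurableSpace G] [BorelSpace G]

/-- Edges of the CAPPED BOX with lower corner `c` on the torus `(ℤ/N)⁴`: edges based at sites `x` with
`(x_k − c_k).val < 3N/4` in every axis.  Non-wrapping (contractible) for `N ≥ 2`; its complement contains, in every
axis `k`, the slab `{x | 3N/4 ≤ (x_k − c_k).val}` of `≥ N/4` consecutive hyperplanes.  (Any fixed fraction in `(0,1)`
would do: `3/4` leaves room inside for the engine's light cones of depth `D ≍ n/(8b)`, `n ≤ S`, and outside for a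
spread wrapping vortex sheet.) -/
def capBox (N : ℕ) (c : Site 4 N) : Set (Edge 4 N) :=
  {e | ∀ k : Fin 4, (e.1 k - c k).val < 3 * N / 4}

/-- **Light-cone Poincaré inequality of the overlapping block sampler** (FORMAT L², v3; the π₁-SAFE re-typing of the
tree's `WilsonBlockHeatBath.GlobalPoincare`): on the torus `(ℤ/N)⁴` with `m = N/b` cells per axis and the tree's
overlapping blocks `B_z` (`InBlock`, side `∈ [2b, 4b]`), for EVERY corner `c` and every bounded measurable
GAUGE-INVARIANT `F` depending only on the links of the capped box `capBox N c`,
`Var_μ F ≤ γ⁻¹ Σ_z ∫ (F − μ[F | extSigma z])² dμ`, `μ = wilsonMeasure ρ β` — i.e. the quadratic form of the block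
heat-bath generator `H = Σ_z Q_z` dominates `γ ·` variance ON THE LIGHT-CONE CLASS (not on all of `L²(μ)^𝒢`: the
light-flux sector signs of a non-simply-connected `G` and their forecasts from boxes of side `N − O(1)` are outside
the class; forecasts from capped boxes are inside and have vanishing variance by slab-lightness of magnetic flux). -/
def LightConePoincare {Nρ : ℕ} (ρ : G →* Matrix (Fin Nρ) (Fin Nρ) ℂ) (β : ℝ) (N b : ℕ) [NeZero N] (γ : ℝ) :
    Prop :=
  ∀ (c : Site 4 N) (F : GaugeConfig 4 N G → ℝ), Measurable F → (∃ B : ℝ, ∀ U, |F U| ≤ B) →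
    IsGaugeInvariant F → DependsOn F (capBox N c) →
      ∫ U, (F U - ∫ V, F V ∂(wilsonMeasure (d := 4) (L := N) ρ β)) ^ 2
          ∂(wilsonMeasure (d := 4) (L := N) ρ β) ≤
        γ⁻¹ * ∑ z : Fin 4 → Fin (N / b),
          ∫ U, (F U - ((wilsonMeasure (d := 4) (L := N) ρ β)[F|extSigma G N (N / b) z]) U) ^ 2
            ∂(wilsonMeasure (d := 4) (L := N) ρ β)

/-- PROVED (one line): the tree's GLOBAL inequality implies the light-cone one — format L² v3 is weaker than the
waypoint `GlobalPoincare` of `Theses/LangevinControlUV.lean` (which item 32 (a) bites at `π₁(G) ≠ 1`). -/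
theorem lightConePoincare_of_globalPoincare {Nρ : ℕ} (ρ : G →* Matrix (Fin Nρ) (Fin Nρ) ℂ) (β : ℝ) (N b : ℕ)
    [NeZero N] (γ : ℝ) (h : WilsonBlockHeatBath.GlobalPoincare ρ β N b γ) : LightConePoincare ρ β N b γ :=
  fun _ F hFm hFb hFi _ => h F hFm hFb hFi

/-- **FORMAT L²: "`(ρ, β)` TENSORISES AT MESH `b` WITH CONSTANT `C`"** (v3) — on EVERY odd torus `2S+1 ≥ 4b` the
light-cone Poincaré inequality of the block sampler with nominal cell `b` holds with `γ = C⁻¹`.  Exterior-free,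
one scale, one constant; group-blind in its TEXT (the π₁-handling is in the class `capBox`, not in a hypothesis on
`G`). -/
def TensorizesAt {Nρ : ℕ} (ρ : G →* Matrix (Fin Nρ) (Fin Nρ) ℂ) (β : ℝ) (b : ℕ) (C : ℝ) : Prop :=
  ∀ S : ℕ, 4 * b ≤ 2 * S + 1 → LightConePoincare ρ β (2 * S + 1) b C⁻¹

/-- PROVED: the light-cone inequality is monotone in the constant (a smaller `γ' ≤ γ` is a weaker claim). -/
theorem lightConePoincare_mono {Nρ : ℕ} (ρ : G →* Matrix (Fin Nρ) (Fin Nρ) ℂ) (β : ℝ) (N b : ℕ) [NeZero N]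
    {γ γ' : ℝ} (hγ' : 0 < γ') (hle : γ' ≤ γ) (h : LightConePoincare ρ β N b γ) :
    LightConePoincare ρ β N b γ' := by
  intro c F hFm hFb hFi hFd
  refine (h c F hFm hFb hFi hFd).trans ?_
  exact mul_le_mul_of_nonneg_right (inv_anti₀ hγ' hle)
    (Finset.sum_nonneg fun z _ => integral_nonneg fun U => sq_nonneg _)

/-- PROVED: tensorisation is monotone in `C` (ctriage-2 rev 8 O-L2-2: the composition may run at `max C C₀`). -/
theorem tensorizesAt_mono {Nρ : ℕ} (ρ : G →* Matrix (Fin Nρ) (Fin Nρ) ℂ) (β : ℝ) (b : ℕ) {C C' : ℝ}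
    (hC : 0 < C) (hle : C ≤ C') (h : TensorizesAt ρ β b C) : TensorizesAt ρ β b C' :=
  fun S hS => lightConePoincare_mono ρ β (2 * S + 1) b (inv_pos.mpr (hC.trans_le hle)) (inv_anti₀ hC hle) (h S hS)

/-- **Card A's certificate (fixed physical block, v3 meaning through `TensorizesAt`):** a physical length `ℓ > 0`, a
constant `C` and a threshold `β₂` such that for `β ≥ β₂` the theory tensorises at mesh `b = ⌈ℓ / a(β)⌉` with
constant `C`. -/
def BlockTensorizationCertificate (r : LatticeRep G) (a : ℝ → ℝ) : Prop :=
  ∃ ℓ : ℝ, 0 < ℓ ∧ ∃ C β₂ : ℝ, 0 < C ∧ ∀ β : ℝ, β₂ ≤ β → TensorizesAt r.ρ β ⌈ℓ / a β⌉₊ C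

end LightConeFormat

/-- **ENGINE (E1) in FORMAT shape — the line's first prover target** (`M/L`, group-blind, model-independent given
torus DLR): for every constant `C` a rate `κ(C) > 0` and a torus factor `s₀` such that tensorisation at mesh `b` with
constant `C` gives clustering of every pair of local species at rate `κ / b` per lattice site on the tori of side
`≥ s₀ b`, the prefactor depending on the species (and `C`) only.  v3 ARCHITECTURE = the LANDED knabe S4 estimate
`Theorems/LangevinControlUVLatticeGapInUVUnitsGapToClustering.lean`
(`GapToClustering.abs_latticeConnectedCorr_le_of_globalPoincare`: exact pull-out
`⟪f̃, g̃⟫ = ⟪P^{Λ_f}_t f̃, P^{Λ_g}_t g̃⟫`, light cone `hLC`, contraction `hSC`, `t = (D+1)/(625e²)`) with TWO deltas: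
(i) `GlobalPoincare ↦ LightConePoincare` — the gap is only ever applied to `u_t = P^{Λ}_t f̃`, which lies in the
closed `H_Λ`-invariant subspace `W(Λ) ⊆ L²` generated by bounded gauge-invariant functions depending on `Reg Λ ⊆ capBox`
(toolkit `WilsonBlockHeatBathLightCone2.exists_localSubspaces`, `…Semigroup.exists_isGaugeInvariant_version_condExp`);
(ii) `hSC ↦ DefectContraction` (§E): on `W(Λ)` the class inequality reads `γ‖x‖² ≤ ⟪H_Λ x, x⟫ + Σ_{z ∈ rim Λ} ‖Q_z x‖²`
(blocks `z ∉ Λ` meeting `Reg Λ`), and along the trajectory the rim terms are `≤ |rim| · (2·LC-tail)²` by a SECOND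
light-cone call (compare `u_s` with the cone of depth `D/2`), so Gronwall gives
`‖u_t‖² ≤ e^{−2γt} ‖f̃‖² + ε²/γ` instead of `e^{−2γt} ‖f̃‖²`; the rest of S4 is verbatim. -/
def BlockEngineFmt : Prop :=
  ∀ C : ℝ, 0 < C → ∃ (κ : ℝ) (s₀ : ℕ), 0 < κ ∧
    ∀ (G : Type) [Group G] [TopologicalSpace G] [IsTopologicalGroup G] [CompactSpace G]
      [MeasurableSpace G] [BorelSpace G] (N : ℕ) (ρ : G →* Matrix (Fin N) (Fin N) ℂ),
      Continuous ρ → Function.Injective ρ → (∀ g, ρ g ∈ Matrix.unitaryGroup (Fin N) ℂ) →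
        ∀ A B : LocalGaugeObservable 4 G, ∃ C' : ℝ,
          ∀ (β : ℝ) (b : ℕ), 1 ≤ b → TensorizesAt ρ β b C →
            ∀ S : ℕ, s₀ * b ≤ 2 * S + 1 → ∀ t : ℕ, t ≤ S →
              |latticeConnectedCorr ρ β (2 * S + 1) A.F B.F t| ≤ C' * Real.exp (-(κ * t / b))

/-- Line-level form of §A's certificate (child of `IR`, fixed-`ℓ` shape). -/
def IRBlockTensorization : Prop :=
  ∀ (G : Type) [Group G] [TopologicalSpace G] [IsTopologicalGroup G] [CompactSpace G],
    IsCompactSimpleLieGroup G → letI : MeasurableSpace G := borel G; haveI : BorelSpace G := ⟨rfl⟩;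
    ∀ (r : LatticeRep G) (a : ℝ → ℝ), (∀ β, 0 < a β) → Tendsto a atTop (𝓝 0) →
      LowerBounds G r a → BlockTensorizationCertificate r a

/-- The fixed-`ℓ` engine as a closed statement. -/
def BlockEngine : Prop :=
  ∀ (G : Type) [Group G] [TopologicalSpace G] [IsTopologicalGroup G] [CompactSpace G]
    [MeasurableSpace G] [BorelSpace G] (r : LatticeRep G) (a : ℝ → ℝ), (∀ β, 0 < a β) → Tendsto a atTop (𝓝 0) →
      BlockTensorizationCertificate r a → GapInUnits G r a

section EngineSeam

variable {G : Type} [Group G] [TopologicalSpace G] [IsTopologicalGroup G] [CompactSpace G]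
  [MeasurableSpace G] [BorelSpace G]

/-- Arithmetic: for `0 < a ≤ ℓ`, `⌈ℓ/a⌉₊ ≤ 2ℓ/a`. -/
theorem ceil_le_two_mul_div {ℓ a : ℝ} (ha : 0 < a) (hal : a ≤ ℓ) :
    (⌈ℓ / a⌉₊ : ℝ) ≤ 2 * ℓ / a := by
  have h1 : (1 : ℝ) ≤ ℓ / a := by rw [le_div_iff₀ ha]; linarith
  have h2 : (⌈ℓ / a⌉₊ : ℝ) < ℓ / a + 1 := Nat.ceil_lt_add_one (by linarith)
  have h3 : ℓ / a + 1 ≤ 2 * ℓ / a := by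
    rw [div_add_one (ne_of_gt ha), div_le_div_iff_of_pos_right ha]; linarith
  linarith

/-- **Fixed-`ℓ` engine from the format engine (PROVED seam):** `BlockEngineFmt → BlockEngine`.  At `b = ⌈ℓ/a(β)⌉₊`
and `a(β) ≤ ℓ` (eventually, since `a → 0`) one has `b ≤ 2ℓ/a(β)`, so the format rate `κ/b` per site is at least
`κ a(β)/(2ℓ)`: `GapInUnits` with `c₁ = κ/(2ℓ)`, `S₁ β = s₀ ⌈ℓ/a β⌉₊`. -/
theorem blockEngine_of_fmt (hE : BlockEngineFmt) : BlockEngine := by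
  intro G _ _ _ _ _ _ r a ha ha0 hT
  obtain ⟨ℓ, hℓ, C, β₂, hC, hcert⟩ := hT
  obtain ⟨κ, s₀, hκ, hF⟩ := hE C hC
  -- eventually a β ≤ ℓ
  have hev : ∀ᶠ β in atTop, a β ≤ ℓ := (ha0.eventually (eventually_le_nhds hℓ))
  obtain ⟨β₃, hβ₃⟩ := hev.exists_forall_of_atTop
  refine ⟨κ / (2 * ℓ), max β₂ β₃, fun β => s₀ * ⌈ℓ / a β⌉₊, by positivity, ?_⟩
  intro A B
  obtain ⟨C', hC'⟩ := hF G r.N r.ρ r.continuous r.injective r.mem_unitary A B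
  refine ⟨C', fun β hβ S n hS hn => ?_⟩
  have hβ2 : β₂ ≤ β := le_trans (le_max_left _ _) hβ
  have hβ3 : β₃ ≤ β := le_trans (le_max_right _ _) hβ
  have hal : a β ≤ ℓ := hβ₃ β hβ3
  have hb1 : 1 ≤ ⌈ℓ / a β⌉₊ := by
    rw [Nat.one_le_ceil_iff]; exact div_pos hℓ (ha β)
  have hS' : s₀ * ⌈ℓ / a β⌉₊ ≤ S := hS
  have hside : s₀ * ⌈ℓ / a β⌉₊ ≤ 2 * S + 1 := by omega
  have hbound := hC' β ⌈ℓ / a β⌉₊ hb1 (hcert β hβ2) S hside n hn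
  refine hbound.trans ?_
  have hC0 : 0 ≤ C' := by
    have h0 : 0 ≤ C' * Real.exp (-(κ * (n : ℝ) / (⌈ℓ / a β⌉₊ : ℝ))) := (abs_nonneg _).trans hbound
    exact nonneg_of_mul_nonneg_left h0 (Real.exp_pos _)
  gcongr
  -- goal: κ / (2ℓ) * a β * n ≤ κ * n / ⌈ℓ/aβ⌉₊
  have hbpos : (0 : ℝ) < (⌈ℓ / a β⌉₊ : ℝ) := by exact_mod_cast hb1
  have hceil : (⌈ℓ / a β⌉₊ : ℝ) ≤ 2 * ℓ / a β := ceil_le_two_mul_div (ha β) hal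
  have hn0 : (0 : ℝ) ≤ (n : ℝ) := by exact_mod_cast Nat.zero_le n
  have hane : a β ≠ 0 := (ha β).ne'
  have hℓne : ℓ ≠ 0 := hℓ.ne'
  rw [le_div_iff₀ hbpos]
  calc κ / (2 * ℓ) * a β * (n : ℝ) * (⌈ℓ / a β⌉₊ : ℝ)
      ≤ κ / (2 * ℓ) * a β * (n : ℝ) * (2 * ℓ / a β) := by
        gcongr
        exact mul_nonneg (mul_nonneg (by positivity) (ha β).le) hn0
    _ = κ * (n : ℝ) := by field_simp

end EngineSeam

/-- Composition to the crux BY NAME (real proof): `BlockEngine → IRBlockTensorization → IR`. -/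
theorem ir_of_blockTensorization (hE : BlockEngine) (hC : IRBlockTensorization) :
    Summit.QuantumFields.YangMills.Theses.BalabanLadder.IR := by
  delta Summit.QuantumFields.YangMills.Theses.BalabanLadder.IR
  intro G _ _ _ _ hG
  letI : MeasurableSpace G := borel G
  haveI : BorelSpace G := ⟨rfl⟩
  intro r a ha ha0 hlb
  exact hE G r a ha ha0 (hC G hG r a ha ha0 hlb)

/-- The fixed-`ℓ` line through the FORMAT engine (real proof): `BlockEngineFmt → IRBlockTensorization → IR`. -/
theorem ir_of_blockTensorization' (hE : BlockEngineFmt) (hC : IRBlockTensorization) :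
    Summit.QuantumFields.YangMills.Theses.BalabanLadder.IR :=
  ir_of_blockTensorization (blockEngine_of_fmt hE) hC

/-! ## §B  Card `tv-wall-split`: the two-rung split of the outer certificate in TV currency (PROVED seam; calibration row) -/

section WallSplit

variable {G : Type} [Group G] [TopologicalSpace G] [IsTopologicalGroup G] [CompactSpace G]
  [MeasurableSpace G] [BorelSpace G]

/-- Frames of mesh `b` (the side condition of `OuterTemperedCond`, verbatim). -/
def IsFrame (b : ℕ) (w : Fin 4 → ℤ → ℤ) : Prop :=
  ∀ i j, w i j + ((b : ℕ) : ℤ) ≤ w i (j + 1) ∧ w i (j + 1) ≤ w i j + 2 * ((b : ℕ) : ℤ)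

/-- **(R1) shell-pair condition for the data class `T`.** -/
def ShellPairCond {N : ℕ} (ρ : G →* Matrix (Fin N) (Fin N) ℂ) (β : ℝ) (b n : ℕ)
    (T : Set (LGConfig 4 G)) (ε₁ : ℝ) : Prop :=
  ∀ w : Fin 4 → ℤ → ℤ, IsFrame b w →
    ∀ Y : Finset (Fin 4 → ℤ), Y ⊆ windowCells n → (0 : Fin 4 → ℤ) ∈ Y →
      ∀ σ σ' : LGConfig 4 G, σ ∈ T → σ' ∈ T →
        (∀ c ∈ windowCellsPlus n, c ∉ Y → c ∈ windowCells n → ∀ e ∈ cellEdges w c, σ e = σ' e) →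
        ∀ f : LGConfig 4 G → ℝ, IsCylinder f (cellEdges w 0) → Measurable f → (∀ U, 0 ≤ f U ∧ f U ≤ 1) →
          |(∫ U, f U ∂(ymSpecification ρ β (regionEdges w Y) σ)) -
            ∫ U, f U ∂(ymSpecification ρ β (regionEdges w Y) σ')| ≤ ε₁

/-- **(R2) wall reduction to the class `T`** (Nielsen–Olesen «skin saturation» in TV currency). -/
def WallReduction {N : ℕ} (ρ : G →* Matrix (Fin N) (Fin N) ℂ) (β : ℝ) (b n : ℕ)
    (T : Set (LGConfig 4 G)) (ε₂ : ℝ) : Prop :=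
  ∀ w : Fin 4 → ℤ → ℤ, IsFrame b w →
    ∀ Y : Finset (Fin 4 → ℤ), Y ⊆ windowCells n → (0 : Fin 4 → ℤ) ∈ Y →
      ∀ σ : LGConfig 4 G, ∃ σT : LGConfig 4 G, σT ∈ T ∧
        (∀ c ∈ windowCellsPlus n, c ∉ Y → c ∈ windowCells n → ∀ e ∈ cellEdges w c, σT e = σ e) ∧
        ∀ f : LGConfig 4 G → ℝ, IsCylinder f (cellEdges w 0) → Measurable f → (∀ U, 0 ≤ f U ∧ f U ≤ 1) →
          |(∫ U, f U ∂(ymSpecification ρ β (regionEdges w Y) σ)) -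
            ∫ U, f U ∂(ymSpecification ρ β (regionEdges w Y) σT)| ≤ ε₂

/-- **The split seam (PROVED): `ShellPairCond T ε₁ → WallReduction T ε₂ → OuterTemperedCond (ε₁ + 2ε₂) δ`.** -/
theorem outerTemperedCond_of_wallSplit {N : ℕ} (ρ : G →* Matrix (Fin N) (Fin N) ℂ) (β : ℝ) (b n : ℕ)
    (T : Set (LGConfig 4 G)) (ε₁ ε₂ δ : ℝ)
    (h1 : ShellPairCond ρ β b n T ε₁) (h2 : WallReduction ρ β b n T ε₂) :
    OuterTemperedCond ρ β b n (ε₁ + 2 * ε₂) δ := by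
  intro w hw
  refine ⟨fun _ => Set.univ, fun _ => MeasurableSet.univ, ?_, ?_, ?_⟩
  · intro c σ σ' _
    simp only [Set.mem_univ]
  · intro Y hY h0Y σ σ' hagree f hf_cyl hfm hf01
    obtain ⟨σT, hσT, hTagree, hTV⟩ := h2 w hw Y hY h0Y σ
    obtain ⟨σT', hσT', hTagree', hTV'⟩ := h2 w hw Y hY h0Y σ'
    have hpair : ∀ c ∈ windowCellsPlus n, c ∉ Y → c ∈ windowCells n →
        ∀ e ∈ cellEdges w c, σT e = σT' e := by
      intro c hc hcY hcW e he
      rcases hagree c hc hcY with h | h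
      · rw [hTagree c hc hcY hcW e he, h e he, ← hTagree' c hc hcY hcW e he]
      · exact absurd hcW h.1
    have hmid := h1 w hw Y hY h0Y σT σT' hσT hσT' hpair f hf_cyl hfm hf01
    have hA := hTV f hf_cyl hfm hf01
    have hB := hTV' f hf_cyl hfm hf01
    rw [abs_sub_comm] at hB
    have htri : ∀ x y xT yT : ℝ, |x - y| ≤ |x - xT| + |xT - yT| + |yT - y| := by
      intro x y xT yT
      calc |x - y| = |(x - xT) + (xT - yT) + (yT - y)| := by congr 1; ring
        _ ≤ |(x - xT) + (xT - yT)| + |yT - y| := abs_add_le _ _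
        _ ≤ |x - xT| + |xT - yT| + |yT - y| := by gcongr; exact abs_add_le _ _
    linarith [htri (∫ U, f U ∂(ymSpecification ρ β (regionEdges w Y) σ))
      (∫ U, f U ∂(ymSpecification ρ β (regionEdges w Y) σ'))
      (∫ U, f U ∂(ymSpecification ρ β (regionEdges w Y) σT))
      (∫ U, f U ∂(ymSpecification ρ β (regionEdges w Y) σT'))]
  · intro c E' _ ζ
    simp only [Set.compl_univ, measure_empty, zero_le]

/-- **The wall-split certificate** for `(G, r, a)`. -/
def WallSplitCertificate (r : LatticeRep G) (a : ℝ → ℝ) : Prop :=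
  ∃ ℓ : ℝ, 0 < ℓ ∧ ∃ (n : ℕ) (ε₁ ε₂ : ℝ), 1 ≤ n ∧ 0 ≤ ε₁ ∧ 0 ≤ ε₂ ∧
    (ε₁ + 2 * ε₂) * ((((4 * n + 3) ^ 4 - (4 * n + 1) ^ 4 : ℕ)) : ℝ) < 1 ∧
    ∃ β₂ : ℝ, ∀ β : ℝ, β₂ ≤ β → ∃ T : Set (LGConfig 4 G),
      ShellPairCond r.ρ β ⌈ℓ / a β⌉₊ n T ε₁ ∧ WallReduction r.ρ β ⌈ℓ / a β⌉₊ n T ε₂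

/-- Certificate-level seam (PROVED): `WallSplitCertificate r a → OuterCertificate r a`. -/
theorem outerCertificate_of_wallSplit (r : LatticeRep G) (a : ℝ → ℝ)
    (h : WallSplitCertificate r a) : OuterCertificate r a := by
  obtain ⟨ℓ, hℓ, n, ε₁, ε₂, hn, hε₁, hε₂, hM, β₂, hβ⟩ := h
  refine ⟨ℓ, hℓ, n, ε₁ + 2 * ε₂, hn, by positivity, hM, fun δ _ => ⟨β₂, fun β hβ₂ => ?_⟩⟩
  obtain ⟨T, h1, h2⟩ := hβ β hβ₂
  exact outerTemperedCond_of_wallSplit r.ρ β _ n T ε₁ ε₂ δ h1 h2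

end WallSplit

/-- Line-level wall split (two rungs behind the v10 `stub_outerCert`; calibration only). -/
def IRWallSplit : Prop :=
  ∀ (G : Type) [Group G] [TopologicalSpace G] [IsTopologicalGroup G] [CompactSpace G],
    IsCompactSimpleLieGroup G → letI : MeasurableSpace G := borel G; haveI : BorelSpace G := ⟨rfl⟩;
    ∀ (r : LatticeRep G) (a : ℝ → ℝ), (∀ β, 0 < a β) → Tendsto a atTop (𝓝 0) →
      LowerBounds G r a → WallSplitCertificate r a

/-- Composition (PROVED): `IRWallSplit → IROuterCertificate`. -/
theorem irOuterCertificate_of_wallSplit (h : IRWallSplit) : IROuterCertificate := by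
  intro G _ _ _ _ hG
  letI : MeasurableSpace G := borel G
  haveI : BorelSpace G := ⟨rfl⟩
  intro r a ha ha0 hlb
  exact outerCertificate_of_wallSplit r a (h G hG r a ha ha0 hlb)

/-! ## §D  Card `l2-onset-pincer` (NEW, g3): the af-pincer split in the exterior-free L² currency

The generic pincer over a mixing format `P : ℝ → ℕ → Prop` (coupling ↦ mesh ↦ Prop) is copied VERBATIM from the
registered hedge cut `AfPincerT` §A (owner p2 g24, `p2-g24-files/line-af-pincer-T.reg.lean` 0308f95ca6f6a115; that file
lives in `pub/`, not in the tree, so it cannot be imported): `fmtSet`, `fmtOnset`, `FmtClustering`,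
`fmtOnset_pinned` (LowerBounds(i) + «Q2 small a factor T below the onset» ⇒ `a β · onset < T`) and
`gapInUnits_of_fmtOnset` (clustering contract at rate `κ/b` + pin ⇒ `GapInUnits`).  The NEW content is the
instantiation at the L² format `P β b := TensorizesAt ρ β b C`, whose three statements carry NO boundary data. -/

section Generic

variable {G : Type} [Group G] [TopologicalSpace G] [IsTopologicalGroup G] [CompactSpace G]
  [MeasurableSpace G] [BorelSpace G]

/-- The meshes `b ≥ 1` at which a format `P` holds at coupling `β` (copy of `AfPincerT.fmtSet`). -/
def fmtSet (P : ℝ → ℕ → Prop) (β : ℝ) : Set ℕ := {b : ℕ | 1 ≤ b ∧ P β b}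

/-- The onset of a format: the least mesh at which it holds (`= 0` if none; copy of `AfPincerT.fmtOnset`). -/
def fmtOnset (P : ℝ → ℕ → Prop) (β : ℝ) : ℕ := sInf (fmtSet P β)

theorem fmtOnset_spec (P : ℝ → ℕ → Prop) (β : ℝ) (h : (fmtSet P β).Nonempty) :
    1 ≤ fmtOnset P β ∧ P β (fmtOnset P β) := Nat.sInf_mem h

theorem fmtOnset_le (P : ℝ → ℕ → Prop) (β : ℝ) {b : ℕ} (hb : 1 ≤ b) (hP : P β b) : fmtOnset P β ≤ b :=
  Nat.sInf_le ⟨hb, hP⟩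

/-- Clustering contract of a format at `(G, r)` with rate `κ` and torus factor `s₀` (copy of `AfPincerT.FmtClustering`). -/
def FmtClustering (r : LatticeRep G) (P : ℝ → ℕ → Prop) (κ : ℝ) (s₀ : ℕ) : Prop :=
  ∀ A B : YMSpecies G, ∃ C : ℝ, ∀ (β : ℝ) (b : ℕ), 1 ≤ b → P β b →
    ∀ S : ℕ, s₀ * b ≤ 2 * S + 1 → ∀ t : ℕ, t ≤ S →
      |latticeConnectedCorr r.ρ β (2 * S + 1) A.F B.F t| ≤ C * Real.exp (-(κ * t / b))

/-- **The generic pincer (PROVED; copy of `AfPincerT.fmtOnset_pinned`).** -/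
theorem fmtOnset_pinned (P : ℝ → ℕ → Prop) (r : LatticeRep G) (a : ℝ → ℝ) (ha : ∀ β, 0 < a β)
    (hlb : LowerBounds G r a)
    (hX : ∀ v : 𝓢(EuclideanSpace ℝ (Fin 4), ℝ), tsupport v ⊆ {y : EuclideanSpace ℝ (Fin 4) | 0 < y 0} →
      ∀ η : ℝ, 0 < η → ∃ T β₁ : ℝ, ∀ β : ℝ, β₁ ≤ β → ∀ s : ℝ, 0 < s →
        T ≤ s * (fmtOnset P β : ℝ) →
          ∃ᶠ (L : ℕ) in atTop, |Q2 G r β L s (thetaTest 4 v) v| ≤ η) :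
    ∃ T β₆ : ℝ, ∀ β : ℝ, β₆ ≤ β → a β * (fmtOnset P β : ℝ) < T := by
  obtain ⟨⟨v, ε₅, β₅, Λ₅, hv, hε₅, hlow⟩, -⟩ := hlb
  obtain ⟨T, β₁, hT⟩ := hX v hv (ε₅ / 2) (half_pos hε₅)
  refine ⟨T, max β₁ β₅, fun β hβ => ?_⟩
  have hβ1 : β₁ ≤ β := le_trans (le_max_left _ _) hβ
  have hβ5 : β₅ ≤ β := le_trans (le_max_right _ _) hβ
  by_contra hge
  rw [not_lt] at hge
  have hfreq := hT β hβ1 (a β) (ha β) hge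
  have hev : ∀ᶠ (L : ℕ) in atTop, Λ₅ ≤ a β * (L : ℝ) :=
    (tendsto_natCast_atTop_atTop.const_mul_atTop (ha β)).eventually_ge_atTop Λ₅
  obtain ⟨L, hL1, hL2⟩ := (hfreq.and_eventually hev).exists
  have hlo := hlow β hβ5 L hL2
  have habs := le_abs_self (Q2 G r β L (a β) (thetaTest 4 v) v)
  linarith

/-- **The generic rate seam (PROVED; copy of `AfPincerT.gapInUnits_of_fmtOnset`).** -/
theorem gapInUnits_of_fmtOnset {P : ℝ → ℕ → Prop} (r : LatticeRep G) (a : ℝ → ℝ) (ha : ∀ β, 0 < a β)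
    {κ : ℝ} {s₀ : ℕ} (hκ : 0 < κ) (hcl : FmtClustering r P κ s₀)
    {β₂ : ℝ} (hon : ∀ β : ℝ, β₂ ≤ β → (fmtSet P β).Nonempty)
    {T β₆ : ℝ} (hpin : ∀ β : ℝ, β₆ ≤ β → a β * (fmtOnset P β : ℝ) < T) :
    GapInUnits G r a := by
  have hT : 0 < T := by
    have h1 := hpin (max β₂ β₆) (le_max_right _ _)
    have h0 : 0 ≤ a (max β₂ β₆) * (fmtOnset P (max β₂ β₆) : ℝ) :=
      mul_nonneg (ha _).le (Nat.cast_nonneg _)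
    linarith
  have hc₁ : 0 < κ / T := div_pos hκ hT
  refine ⟨κ / T, max β₂ β₆, fun β => s₀ * fmtOnset P β, hc₁, ?_⟩
  intro A B
  obtain ⟨C, hCb⟩ := hcl A B
  refine ⟨C, fun β hβ S t hS ht => ?_⟩
  have hβ2 : β₂ ≤ β := le_trans (le_max_left _ _) hβ
  have hβ6 : β₆ ≤ β := le_trans (le_max_right _ _) hβ
  obtain ⟨hb1, hP1⟩ := fmtOnset_spec P β (hon β hβ2)
  have hbpos : (0 : ℝ) < (fmtOnset P β : ℝ) := by exact_mod_cast hb1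
  have hS' : s₀ * fmtOnset P β ≤ S := hS
  have hside : s₀ * fmtOnset P β ≤ 2 * S + 1 := by omega
  have hbound := hCb β (fmtOnset P β) hb1 hP1 S hside t ht
  have hC0 : 0 ≤ C := by
    have h0 : 0 ≤ C * Real.exp (-(κ * (t : ℝ) / (fmtOnset P β : ℝ))) := (abs_nonneg _).trans hbound
    exact nonneg_of_mul_nonneg_left h0 (Real.exp_pos _)
  refine hbound.trans ?_
  gcongr
  have ht0 : (0 : ℝ) ≤ (t : ℝ) := by exact_mod_cast Nat.zero_le t
  have hab : a β * (fmtOnset P β : ℝ) < T := hpin β hβ6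
  rw [le_div_iff₀ hbpos]
  calc κ / T * a β * (t : ℝ) * (fmtOnset P β : ℝ)
      = κ / T * (t : ℝ) * (a β * (fmtOnset P β : ℝ)) := by ring
    _ ≤ κ / T * (t : ℝ) * T := by gcongr
    _ = κ * (t : ℝ) := by field_simp

end Generic

section L2Pincer

variable {G : Type} [Group G] [TopologicalSpace G] [IsTopologicalGroup G] [CompactSpace G]
  [MeasurableSpace G] [BorelSpace G]

/-- The set of TENSORISING meshes at `(ρ, β, C)` (generic `fmtSet` of format L²). -/
def tensSet {N : ℕ} (ρ : G →* Matrix (Fin N) (Fin N) ℂ) (β : ℝ) (C : ℝ) : Set ℕ :=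
  fmtSet (fun β' b => TensorizesAt ρ β' b C) β

/-- **The tensorisation onset** `b⋆_{L²}(ρ, β, C)`: the least tensorising mesh (`= 0` if none). -/
def tensOnset {N : ℕ} (ρ : G →* Matrix (Fin N) (Fin N) ℂ) (β : ℝ) (C : ℝ) : ℕ :=
  fmtOnset (fun β' b => TensorizesAt ρ β' b C) β

end L2Pincer

/-- **Stub I_{L²} — ONSET TENSORISATION** (research, XL — IR side; v3 meaning through `LightConePoincare`).  For every
compact simple `G` and every `r`: ONE constant `C > 0` and a threshold `β₂` beyond which SOME mesh `b ≥ 1` tensorises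
(every odd torus of side `≥ 4b`).  Fixed-`β`, mesh free (the onset may grow as fast as it likes with `β`): no unit
map, no `LowerBounds`, no boundary data, no typical class.  The bet: uniqueness-and-clustering of the weak-coupling
phase at each fixed `β`, stated as a block heat-bath Poincaré inequality on the LIGHT-CONE class.  Simplicity of `G`
is load-bearing (photon: a linear functional of the links of a capped box has `Var ≍ (S/b)² ×` its block-conditional
variance).  `π₁(G) ≠ 1` is handled by the CLASS, at the price of the honest residual K6′ INSIDE this statement: flux
sectors are not readable from capped boxes (slab-lightness of magnetic flux, the confining-phase counterpart of the
tree's `LightFluxMode` hypothesis) — for `G` simply connected there is no residual. -/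
def OnsetTensorization : Prop :=
  ∀ (G : Type) [Group G] [TopologicalSpace G] [IsTopologicalGroup G] [CompactSpace G],
    IsCompactSimpleLieGroup G → letI : MeasurableSpace G := borel G; haveI : BorelSpace G := ⟨rfl⟩;
    ∀ r : LatticeRep G, ∃ C : ℝ, 0 < C ∧ ∃ β₂ : ℝ, ∀ β : ℝ, β₂ ≤ β → ∃ b : ℕ, 1 ≤ b ∧ TensorizesAt r.ρ β b C

/-! ### §F — The UV stub parametrised by the format (ctriage-1 rev 7 sharpen (iii); ctriage-2 rev 8 O-L2-2)

`AFToOnsetAtRep fmt G r` is the per-representation text of `AFToOnsetT` ∕ `AFToOnsetL2` with the ONSET FUNCTIONAL as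
a parameter: `fmt : Format` is a format predicate `(ρ, β, b) ↦ Prop` (polymorphic in the group), its onset the
generic `fmtOnset` of §C; `AFToOnsetAt fmt` quantifies it over simple `G` and `r`.  Cut T's `AFToOnsetT` is
`AFToOnsetAt` of `(ρ, β, b) ↦ MixesAtT …` verbatim (the T module is a desk file, so that `iff` is the cplan desk's
one-liner); `AFToOnsetL2` below is BY DEFINITION the parametrised stub at the L² format, for all constants beyond a
threshold `C₀` of the prover's choosing (O-L2-2: v3 asked `∀ C > 0`, more than the composition consumes; stub I's
`C` is met at `max C C₀` through `tensorizesAt_mono`). -/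

/-- A FORMAT: for every compact group (with its Borel structure) and every unitary matrix representation, a
predicate «mesh `b` is good at coupling `β`». -/
abbrev Format : Type 1 :=
  ∀ (G : Type) [Group G] [TopologicalSpace G] [IsTopologicalGroup G] [CompactSpace G] [MeasurableSpace G]
    [BorelSpace G] {N : ℕ}, (G →* Matrix (Fin N) (Fin N) ℂ) → ℝ → ℕ → Prop

/-- The L² format at constant `C`: `(ρ, β, b) ↦ TensorizesAt ρ β b C`. -/
def tensFmt (C : ℝ) : Format :=
  fun G _ _ _ _ _ _ {_N} ρ β b => TensorizesAt (G := G) ρ β b C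

/-- **Stub X parametrised by the format, at one representation** — asymptotic freedom up to the onset of `fmt`: at
every unit `s` a factor `T` below the `fmt`-onset the two-point quantity `Q2` is `≤ η` along infinitely many tori. -/
def AFToOnsetAtRep (fmt : Format) (G : Type) [Group G] [TopologicalSpace G] [IsTopologicalGroup G]
    [CompactSpace G] [MeasurableSpace G] [BorelSpace G] (r : LatticeRep G) : Prop :=
  ∀ v : 𝓢(EuclideanSpace ℝ (Fin 4), ℝ), tsupport v ⊆ {y : EuclideanSpace ℝ (Fin 4) | 0 < y 0} →
    ∀ η : ℝ, 0 < η → ∃ T β₁ : ℝ, ∀ β : ℝ, β₁ ≤ β → ∀ s : ℝ, 0 < s →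
      T ≤ s * (fmtOnset (fmt G r.ρ) β : ℝ) →
        ∃ᶠ (L : ℕ) in atTop, |Q2 G r β L s (thetaTest 4 v) v| ≤ η

/-- **Stub X parametrised by the format** (all simple `G`, all `r`). -/
def AFToOnsetAt (fmt : Format) : Prop :=
  ∀ (G : Type) [Group G] [TopologicalSpace G] [IsTopologicalGroup G] [CompactSpace G],
    IsCompactSimpleLieGroup G → letI : MeasurableSpace G := borel G; haveI : BorelSpace G := ⟨rfl⟩;
    ∀ (r : LatticeRep G), AFToOnsetAtRep fmt G r

/-- **Stub X_{L²} — ASYMPTOTIC FREEDOM UP TO THE TENSORISATION ONSET** (research, L–XL — UV side; v3.2 typing per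
ctriage-2 rev 8 O-L2-2): for every simple `G` and `r` there is a threshold `C₀ > 0` such that for every constant
`C ≥ C₀` the parametrised stub holds at the L² format `tensFmt C` — at every unit `s` a factor `T` below the
tensorisation onset `b⋆_{L²}(ρ, β, C)` the two-point quantity `Q2` is `≤ η` along infinitely many tori.  (Larger `C`
= smaller onset = weaker claim; the composition runs at `max C_I C₀`.) -/
def AFToOnsetL2 : Prop :=
  ∀ (G : Type) [Group G] [TopologicalSpace G] [IsTopologicalGroup G] [CompactSpace G],
    IsCompactSimpleLieGroup G → letI : MeasurableSpace G := borel G; haveI : BorelSpace G := ⟨rfl⟩;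
    ∀ (r : LatticeRep G), ∃ C₀ : ℝ, 0 < C₀ ∧ ∀ C : ℝ, C₀ ≤ C → AFToOnsetAtRep (tensFmt C) G r

section L2PincerComposition

variable {G : Type} [Group G] [TopologicalSpace G] [IsTopologicalGroup G] [CompactSpace G]
  [MeasurableSpace G] [BorelSpace G]

/-- The format engine at `(G, r, C)` is a clustering contract for format L² (bookkeeping). -/
theorem fmtClustering_l2_of_engine (hE : BlockEngineFmt) (r : LatticeRep G) {C : ℝ} (hC : 0 < C) :
    ∃ (κ : ℝ) (s₀ : ℕ), 0 < κ ∧ FmtClustering r (fun β b => TensorizesAt r.ρ β b C) κ s₀ := by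
  obtain ⟨κ, s₀, hκ, hF⟩ := hE C hC
  refine ⟨κ, s₀, hκ, fun A B => ?_⟩
  obtain ⟨C', hC'⟩ := hF G r.N r.ρ r.continuous r.injective r.mem_unitary A B
  exact ⟨C', fun β b hb hP S hS t ht => hC' β b hb hP S hS t ht⟩

end L2PincerComposition

/-- **Composition of the L² pincer at the level of `IR`'s body (real proof):**
`BlockEngineFmt → OnsetTensorization → AFToOnsetL2 → IRCal`, through the generic seams at
`P β b := TensorizesAt r.ρ β b (max C C₀)`, `C` the constant of stub I_{L²}, `C₀` the threshold of stub X_{L²}. -/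
theorem irCal_of_pincerL2 (hE : BlockEngineFmt) (hI : OnsetTensorization) (hX : AFToOnsetL2) : IRCal := by
  intro G _ _ _ _ hG
  letI : MeasurableSpace G := borel G
  haveI : BorelSpace G := ⟨rfl⟩
  intro r a ha _ hlb
  obtain ⟨C, hC, β₂, hon⟩ := hI G hG r
  obtain ⟨C₀, hC₀, hX'⟩ := hX G hG r
  have hC' : 0 < max C C₀ := lt_max_of_lt_left hC
  obtain ⟨κ, s₀, hκ, hcl⟩ := fmtClustering_l2_of_engine hE r hC'
  obtain ⟨T, β₆, hpin⟩ :=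
    fmtOnset_pinned (fun β' b => TensorizesAt r.ρ β' b (max C C₀)) r a ha hlb (hX' (max C C₀) (le_max_right _ _))
  exact gapInUnits_of_fmtOnset r a ha hκ hcl
    (fun β hβ => by
      obtain ⟨b, hb, hP⟩ := hon β hβ
      exact ⟨b, hb, tensorizesAt_mono r.ρ β b hC (le_max_left _ _) hP⟩) hpin

/-- **The L² pincer concludes the route decl BY NAME** (real proof; the three statements enter as hypotheses —
nothing is registered from this desk). -/
theorem ir_of_pincerL2 (hE : BlockEngineFmt) (hI : OnsetTensorization) (hX : AFToOnsetL2) :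
    Summit.QuantumFields.YangMills.Theses.BalabanLadder.IR := by
  have h : IRCal := irCal_of_pincerL2 hE hI hX
  delta Summit.QuantumFields.YangMills.Theses.BalabanLadder.IR
  delta Summit.QuantumFields.YangMills.Cruxes.IR.CellTempered.IRCal at h
  exact h

/-- Bookkeeping (PROVED): the fixed-`ℓ` certificate bounds the tensorisation onset, `tensOnset ≤ ⌈ℓ/a β⌉₊` for
`β ≥ β₂` — the L² pincer's stub I_{L²} is implied by §A's certificate line (`IRBlockTensorization` ⇒ stub I_{L²}
under `LowerBounds`), so the pincer is the WEAKER-IR-side ∕ STRONGER-UV-side re-cut of the same currency. -/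
theorem tensOnset_le_of_certificate {G : Type} [Group G] [TopologicalSpace G] [IsTopologicalGroup G]
    [CompactSpace G] [MeasurableSpace G] [BorelSpace G] (r : LatticeRep G) (a : ℝ → ℝ) (ha : ∀ β, 0 < a β)
    {ℓ C β₂ : ℝ} (hℓ : 0 < ℓ) (hcert : ∀ β : ℝ, β₂ ≤ β → TensorizesAt r.ρ β ⌈ℓ / a β⌉₊ C)
    {β : ℝ} (hβ : β₂ ≤ β) : tensOnset r.ρ β C ≤ ⌈ℓ / a β⌉₊ :=
  fmtOnset_le _ β (by rw [Nat.one_le_ceil_iff]; exact div_pos hℓ (ha β)) (hcert β hβ)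


/-! ## §E  The engine delta over the landed toolkit, typed (v3) -/

section EngineDelta

open scoped InnerProductSpace

/-- **`DefectContraction` — the replacement of knabe S4's abstract hypothesis `hSC`** when the Poincaré inequality is
only available on an `H`-invariant closed subspace `W` UP TO A DEFECT form `⟪R x, x⟫` (here: `H = H_Λ` the light-cone
generator, `W = W(Λ)`, `R = Σ_{z ∈ rim Λ} Q_z`), and the defect is small ALONG THE TRAJECTORY (here: by the light
cone): Gronwall for `φ(t) = ‖e^{−tH} x‖²`, `φ' = −2⟪H u, u⟫ ≤ −2γ φ + 2ε²`.  Mathlib-only, `S/M`-sized (derivative of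
`s ↦ ‖exp(−sH) x‖²` + `gronwallBound`); stated, not proved, on this desk. -/
def DefectContraction : Prop :=
  ∀ (E : Type) [NormedAddCommGroup E] [InnerProductSpace ℝ E] [CompleteSpace E]
    (H R : E →L[ℝ] E) (W : Submodule ℝ E) (γ ε : ℝ), 0 < γ → IsSelfAdjoint H → IsClosed (W : Set E) →
    (∀ x ∈ W, H x ∈ W) → (∀ x ∈ W, γ * ‖x‖ ^ 2 ≤ ⟪H x, x⟫_ℝ + ⟪R x, x⟫_ℝ) →
    ∀ (t : ℝ), 0 ≤ t → ∀ x ∈ W,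
      (∀ s ∈ Set.Icc (0 : ℝ) t,
        ⟪R (NormedSpace.exp (-(s • H)) x), NormedSpace.exp (-(s • H)) x⟫_ℝ ≤ ε ^ 2) →
      ‖NormedSpace.exp (-(t • H)) x‖ ^ 2 ≤ Real.exp (-(2 * γ * t)) * ‖x‖ ^ 2 + ε ^ 2 / γ

variable {G : Type} [Group G] [TopologicalSpace G] [IsTopologicalGroup G] [CompactSpace G]
  [MeasurableSpace G] [BorelSpace G]

/-- PROVED: a global Poincaré constant `C⁻¹` on every odd torus `≥ 4b` (the knabe waypoint shape) gives
tensorisation at mesh `b` with constant `C` — the L² pincer's currency is implied by, and strictly safer than, the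
torus-global one. -/
theorem tensorizesAt_of_globalPoincare {Nρ : ℕ} (ρ : G →* Matrix (Fin Nρ) (Fin Nρ) ℂ) (β : ℝ) (b : ℕ) (C : ℝ)
    (h : ∀ S : ℕ, 4 * b ≤ 2 * S + 1 → WilsonBlockHeatBath.GlobalPoincare ρ β (2 * S + 1) b C⁻¹) :
    TensorizesAt ρ β b C :=
  fun S hS => lightConePoincare_of_globalPoincare ρ β (2 * S + 1) b C⁻¹ (h S hS)

end EngineDelta

/-! ## §G  The consumed pinning `X′_{L²}` (v3.3, g5 — ctriage-1 rev 8 ADDENDUM items 47–49, sharpen (iv))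

Owner R50 (`p2-g27-files/Sketch-g27-XT.lean` §X′: `OnsetInUnits`, `onsetInUnits_of_afToOnsetT`,
`irCal_of_pincerT'`): the composition of a pincer consumes from its UV stub ONLY the pinning
«`a β · onset(β) < T` for `β` large» under the floors `LowerBounds`.  Crux-triage seat 1 rev 8 item 49
(sharpen (iv), non-blocking) asks for that pinning to be typed next to `AFToOnsetL2`, in THRESHOLD form, with the
NON-EMPTINESS GUARD `(tensSet …).Nonempty →` explicit — because `sInf ∅ = 0`: where the tensorising set is empty
the unguarded inequality degenerates to `0 < T`, and the antitonicity of `tensOnset` in the constant `C` (hence the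
collapse of `∀ C ≥ C₀` to the single constant `max C_I C₀`) holds ONLY where `tensSet` is non-empty — which is what
stub I_{L²} supplies.  This section types the pinning generically in the format (`OnsetInUnitsAtRep (fmt : Format)`:
the T-side twin X_T′ is the same text at the T format for each admissible `(n, ε, δ)`, unguarded in R50), proves
`AFToOnsetL2 → OnsetInUnitsL2` (= `fmtOnset_pinned`, guard discarded), the guarded antitonicity `tensOnset_anti`,
the single-constant collapse `pincerL2Single_of`, and the composition from the pinning alone
`irCal_of_pincerL2'` ∕ `ir_of_pincerL2'` (⊢ `IR` by name).  Nothing registered; every `theorem` is a real proof. -/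

section Pinning

variable {G : Type} [Group G] [TopologicalSpace G] [IsTopologicalGroup G] [CompactSpace G]
  [MeasurableSpace G] [BorelSpace G]

/-- PROVED: the tensorising set grows with the constant. -/
theorem tensSet_mono {N : ℕ} (ρ : G →* Matrix (Fin N) (Fin N) ℂ) (β : ℝ) {C C' : ℝ} (hC : 0 < C)
    (hle : C ≤ C') : tensSet ρ β C ⊆ tensSet ρ β C' :=
  fun b hb => ⟨hb.1, tensorizesAt_mono ρ β b hC hle hb.2⟩

/-- PROVED — the GUARD is essential: where `tensSet ρ β C` is NON-EMPTY the onset is antitone in the constant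
(`C ≤ C' ⇒ b⋆(C') ≤ b⋆(C)`); without the guard it is false (`tensSet ρ β C = ∅ ≠ tensSet ρ β C'` gives
`tensOnset ρ β C = 0 < tensOnset ρ β C'`). -/
theorem tensOnset_anti {N : ℕ} (ρ : G →* Matrix (Fin N) (Fin N) ℂ) (β : ℝ) {C C' : ℝ} (hC : 0 < C)
    (hle : C ≤ C') (hne : (tensSet ρ β C).Nonempty) : tensOnset ρ β C' ≤ tensOnset ρ β C := by
  obtain ⟨hb1, hP⟩ := fmtOnset_spec (fun β' b => TensorizesAt ρ β' b C) β hne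
  exact fmtOnset_le _ β hb1 (tensorizesAt_mono ρ β _ hC hle hP)

/-- The generic rate seam from a GUARDED pin (PROVED): non-emptiness beyond `β₂` turns the guarded pin into the
unguarded one beyond `max β₂ β₆`; then `gapInUnits_of_fmtOnset`. -/
theorem gapInUnits_of_fmtOnset_guarded {P : ℝ → ℕ → Prop} (r : LatticeRep G) (a : ℝ → ℝ) (ha : ∀ β, 0 < a β)
    {κ : ℝ} {s₀ : ℕ} (hκ : 0 < κ) (hcl : FmtClustering r P κ s₀)
    {β₂ : ℝ} (hon : ∀ β : ℝ, β₂ ≤ β → (fmtSet P β).Nonempty)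
    {T β₆ : ℝ} (hpin : ∀ β : ℝ, β₆ ≤ β → (fmtSet P β).Nonempty → a β * (fmtOnset P β : ℝ) < T) :
    GapInUnits G r a :=
  gapInUnits_of_fmtOnset r a ha hκ hcl hon (T := T) (β₆ := max β₂ β₆)
    (fun β hβ => hpin β (le_trans (le_max_right _ _) hβ) (hon β (le_trans (le_max_left _ _) hβ)))

end Pinning

/-- **X′ at one representation, PARAMETRISED BY THE FORMAT — onset in units, guarded.**  For every unit map `a`
(positive, `→ 0`) carrying the floors `LowerBounds G r a` there are `T, β₆` with `a β · onset_fmt(ρ, β) < T` for every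
`β ≥ β₆` AT WHICH THE FORMAT HOLDS AT SOME MESH `b ≥ 1`.  Reading: «the floors at scale `1/a` force the format by
scale `T/a` — wherever it holds at all»; no asymptotic-freedom vocabulary, no quantifier over units `s`. -/
def OnsetInUnitsAtRep (fmt : Format) (G : Type) [Group G] [TopologicalSpace G] [IsTopologicalGroup G]
    [CompactSpace G] [MeasurableSpace G] [BorelSpace G] (r : LatticeRep G) : Prop :=
  ∀ a : ℝ → ℝ, (∀ β, 0 < a β) → Tendsto a atTop (𝓝 0) → LowerBounds G r a →
    ∃ T β₆ : ℝ, ∀ β : ℝ, β₆ ≤ β → (fmtSet (fmt G r.ρ) β).Nonempty → a β * (fmtOnset (fmt G r.ρ) β : ℝ) < T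

/-- X′ at a format, all simple `G` and all `r`. -/
def OnsetInUnitsAt (fmt : Format) : Prop :=
  ∀ (G : Type) [Group G] [TopologicalSpace G] [IsTopologicalGroup G] [CompactSpace G],
    IsCompactSimpleLieGroup G → letI : MeasurableSpace G := borel G; haveI : BorelSpace G := ⟨rfl⟩;
    ∀ (r : LatticeRep G), OnsetInUnitsAtRep fmt G r

/-- **X′_{L²} — TENSORISATION ONSET IN UNITS** (the consumed content of `AFToOnsetL2`; threshold form of v3.2,
guard explicit, per ctriage-1 rev 8 item 49): for every simple `G` and `r` a threshold `C₀ > 0` such that for every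
`C ≥ C₀`, under the floors, `a β · b⋆_{L²}(ρ, β, C) < T` for `β` large wherever `tensSet ρ β C ≠ ∅`. -/
def OnsetInUnitsL2 : Prop :=
  ∀ (G : Type) [Group G] [TopologicalSpace G] [IsTopologicalGroup G] [CompactSpace G],
    IsCompactSimpleLieGroup G → letI : MeasurableSpace G := borel G; haveI : BorelSpace G := ⟨rfl⟩;
    ∀ (r : LatticeRep G), ∃ C₀ : ℝ, 0 < C₀ ∧ ∀ C : ℝ, C₀ ≤ C → OnsetInUnitsAtRep (tensFmt C) G r

/-- X ⇒ X′ at any format and representation (PROVED: the generic pincer `fmtOnset_pinned`; the guard is discarded —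
the converse fails, X quantifies over every unit `s` and does not get to use the floors). -/
theorem onsetInUnitsAtRep_of_afToOnsetAtRep (fmt : Format) (G : Type) [Group G] [TopologicalSpace G]
    [IsTopologicalGroup G] [CompactSpace G] [MeasurableSpace G] [BorelSpace G] (r : LatticeRep G)
    (hX : AFToOnsetAtRep fmt G r) : OnsetInUnitsAtRep fmt G r := by
  intro a ha _ hlb
  obtain ⟨T, β₆, hpin⟩ := fmtOnset_pinned (fmt G r.ρ) r a ha hlb hX
  exact ⟨T, β₆, fun β hβ _ => hpin β hβ⟩

/-- X ⇒ X′ at a format (PROVED). -/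
theorem onsetInUnitsAt_of_afToOnsetAt (fmt : Format) (hX : AFToOnsetAt fmt) : OnsetInUnitsAt fmt := by
  intro G _ _ _ _ hG
  letI : MeasurableSpace G := borel G
  haveI : BorelSpace G := ⟨rfl⟩
  intro r
  exact onsetInUnitsAtRep_of_afToOnsetAtRep fmt G r (hX G hG r)

/-- **X_{L²} ⇒ X′_{L²}** (PROVED; threshold carried along). -/
theorem onsetInUnitsL2_of_afToOnsetL2 (hX : AFToOnsetL2) : OnsetInUnitsL2 := by
  intro G _ _ _ _ hG
  letI : MeasurableSpace G := borel G
  haveI : BorelSpace G := ⟨rfl⟩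
  intro r
  obtain ⟨C₀, hC₀, h⟩ := hX G hG r
  exact ⟨C₀, hC₀, fun C hC => onsetInUnitsAtRep_of_afToOnsetAtRep (tensFmt C) G r (h C hC)⟩

/-- **The SINGLE-CONSTANT form of the pair (I_{L²}, X′_{L²})** (item 49's collapse, typed): ONE constant `C > 0` at
which (i) beyond some `β₂` the tensorising set is non-empty and (ii) the guarded pinning holds. -/
def PincerL2Single : Prop :=
  ∀ (G : Type) [Group G] [TopologicalSpace G] [IsTopologicalGroup G] [CompactSpace G],
    IsCompactSimpleLieGroup G → letI : MeasurableSpace G := borel G; haveI : BorelSpace G := ⟨rfl⟩;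
    ∀ r : LatticeRep G, ∃ C : ℝ, 0 < C ∧
      (∃ β₂ : ℝ, ∀ β : ℝ, β₂ ≤ β → (tensSet r.ρ β C).Nonempty) ∧ OnsetInUnitsAtRep (tensFmt C) G r

/-- PROVED (the collapse): stub I at `C_I` and the threshold pinning at `C₀` give the single-constant form at
`max C_I C₀` — non-emptiness is transported UP in the constant by `tensSet_mono`, the pinning instantiated at
`max C_I C₀ ≥ C₀`.  (This is exactly where `∀ C ≥ C₀` is used, and why it does not collapse to `C = C₀` alone.) -/
theorem pincerL2Single_of (hI : OnsetTensorization) (hX' : OnsetInUnitsL2) : PincerL2Single := by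
  intro G _ _ _ _ hG
  letI : MeasurableSpace G := borel G
  haveI : BorelSpace G := ⟨rfl⟩
  intro r
  obtain ⟨C, hC, β₂, hon⟩ := hI G hG r
  obtain ⟨C₀, hC₀, hX⟩ := hX' G hG r
  refine ⟨max C C₀, lt_max_of_lt_left hC, ⟨β₂, fun β hβ => ?_⟩, hX (max C C₀) (le_max_right _ _)⟩
  obtain ⟨b, hb, hP⟩ := hon β hβ
  exact ⟨b, tensSet_mono r.ρ β hC (le_max_left _ _) (show b ∈ tensSet r.ρ β C from ⟨hb, hP⟩)⟩

/-- **Composition from the single-constant form (real proof):** `BlockEngineFmt → PincerL2Single → IRCal`. -/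
theorem irCal_of_pincerL2Single (hE : BlockEngineFmt) (h : PincerL2Single) : IRCal := by
  intro G _ _ _ _ hG
  letI : MeasurableSpace G := borel G
  haveI : BorelSpace G := ⟨rfl⟩
  intro r a ha hA hlb
  obtain ⟨C, hC, ⟨β₂, hon⟩, hX⟩ := h G hG r
  obtain ⟨κ, s₀, hκ, hcl⟩ := fmtClustering_l2_of_engine hE r hC
  obtain ⟨T, β₆, hpin⟩ := hX a ha hA hlb
  exact gapInUnits_of_fmtOnset_guarded r a ha hκ hcl hon hpin

/-- **Composition consuming ONLY the pinning (real proof):**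
`BlockEngineFmt → OnsetTensorization → OnsetInUnitsL2 → IRCal`. -/
theorem irCal_of_pincerL2' (hE : BlockEngineFmt) (hI : OnsetTensorization) (hX' : OnsetInUnitsL2) : IRCal :=
  irCal_of_pincerL2Single hE (pincerL2Single_of hI hX')

/-- The pinning cut concludes the route decl BY NAME (hypotheses form; nothing registered). -/
theorem ir_of_pincerL2' (hE : BlockEngineFmt) (hI : OnsetTensorization) (hX' : OnsetInUnitsL2) :
    Summit.QuantumFields.YangMills.Theses.BalabanLadder.IR := by
  have h : IRCal := irCal_of_pincerL2' hE hI hX'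
  delta Summit.QuantumFields.YangMills.Theses.BalabanLadder.IR
  delta Summit.QuantumFields.YangMills.Cruxes.IR.CellTempered.IRCal at h
  exact h

/-- Consistency (PROVED): the v3.2 composition factors through the pinning — `AFToOnsetL2` enters `IR` only through
`OnsetInUnitsL2`. -/
theorem irCal_of_pincerL2_via_pinning (hE : BlockEngineFmt) (hI : OnsetTensorization) (hX : AFToOnsetL2) :
    IRCal :=
  irCal_of_pincerL2' hE hI (onsetInUnitsL2_of_afToOnsetL2 hX)

end Summit.QuantumFields.YangMills.Cruxes.IR.CruxIdea3

end
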